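import Literature.NumberTheory.EllipticCurves.OrdinaryReductionTorsionCharacters
import Literature.NumberTheory.EllipticCurves.OrdinaryReductionTorsionLineProofs
import HarnessLib

/-!
# The kernel of reduction `C_v ⊂ E[p^∞]` at a good ordinary place `v ∣ p`, I: the PINNED
# reduction map `E(K̄) → Ẽ(k_w)` — kernel `= ι⁻¹ E₁(K̄_v)`, stability, inertia invariance, counts

`Proofs` file (theorems only: no definition, no named fact, no instance, no `sorry`), topic
`NumberTheory/EllipticCurves`; first of three files discharging the two named facts of
`OrdinaryReductionTorsionCharacters` (R. Greenberg, *Iwasawa theory for elliptic curves*,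
LNM 1716 (1999), §2, pp. 70–71 and 76: the characters `ψ` on `C_v = Ê[p^∞]` and `φ` on
`E[p^∞]/C_v` at a place of good ordinary reduction above `p`).  Sequels:
`OrdinaryReductionTorsionCharactersProofs` (the Tate module `T_p(C_v)`, F4a
`ordinaryReduction_inertia_smul_of_mem_kernelReduction_holds`) and
`OrdinaryReductionUnramifiedCharacterProofs` (F4b).

Everything is read off the tree's construction behind the THEOREM
`ellipticOrdinaryReduction_tateModule_filtration_holds` (Greenberg 1991 §2: the line
`F¹ = ker V_p(red) ⊂ V_pE`, `OrdinaryReductionTateModuleProofs` Part II), which this file PINS to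
the tree's named local objects so that the kernel of the reduction map is literally the named
facts' `C_v = {P | ι P ∈ W.localKernelOfReduction v}`:

* `exists_pinnedSetup` — with `w = |·|_v` the CHOSEN spectral valuation `v.spectralValuation`
  (`IwasawaSelmerSupersingularLocalProofs` Part C), the structure map `φ : 𝓞_v → 𝒪_w`, the model
  `MO = M.map φ` of the local minimal model `M = W.localMinimalIntegralModel v` over the valuation
  ring `𝒪_w` of `K̄_v` (unit discriminant at a good `v`), and `M_{K̄_v} = MO_{K̄_v}`;
* the **pinned reduction map** `f = red ∘ Φ ∘ ι : E(K̄) → MO~(k_w)` — `red = goodReductionHom MO`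
  (Silverman VII.2.1), `Φ = W.localPointsEquivModel v` (the `K_v`-rational change of variables
  to the minimal model on `K̄_v`-points, `Γ_{K_v}`-equivariant: `localPointsEquivModel_smul`),
  `ι = pointsMap W K_v` (the chosen embedding `E(K̄) → E(K̄_v)`) — enters every lemma through
  the hypothesis `hf` (as in `goodReduction_reduction_line`), no definition being made;
* `reductionMap_eq_zero_iff_mem_localKernelOfReduction` — **`f a = 0 ↔ ι a ∈ E₁(K̄_v)`**
  (`goodReductionHom_eq_zero_iff`, `mem_localKernelOfReduction_iff_of_eq_some`: both say that
  the point of the minimal model has non-integral `x`);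
* `reductionMap_stable_invariant_counts` — at a good ORDINARY `v ∣ p`: `ker f` is
  `Γ_{K_v}`-stable and `f` is inertia-invariant (`goodReduction_reduction_line`,
  `OrdinaryReductionTorsionLineProofs`, at `Φ₀ = W.localPointsEquivModel v`); `#E(K̄)[pⁿ] = p²ⁿ`,
  `#MO~(k_w)[pⁿ] = pⁿ`, and `f` maps `E(K̄)[pⁿ]` onto `MO~(k_w)[pⁿ]` — Steps 2–3 and 6 of
  Part II of `OrdinaryReductionTateModuleProofs` VERBATIM (`natDegree_ΨSq_ne_zero_of_not_dvd_trace`,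
  `exists_zsmul_eq_zero_goodReductionHom_ne_zero`, `natCard_torsionBy_ker_goodReductionHom_eq`,
  `exists_mem_torsionBy_eq_of_injective`; Greenberg LNM 1716 p. 62, Silverman V.3.1, III.6.4).

## References

* [GreenbergLNM1716] R. Greenberg, LNM 1716 (1999), §2, p. 62, pp. 70–71, p. 76.
* [Greenberg1991] R. Greenberg, *Iwasawa theory for motives*, LMS LNS 153 (1991), §2, p. 214.
* [SerreInventiones1972] J.-P. Serre, Invent. Math. 15 (1972), §1.11 Prop. 11 and Cor.
* [SilvermanAEC2009] J. H. Silverman, *AEC* 2nd ed., III.6.4, V.3.1, VII.2.1–2.2, VII.5.1.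

## Design

No definitions: the local data `(φ, hΔO, hX, f, hf)` are hypotheses of the lemmas and are
produced by `exists_pinnedSetup` (+ `rfl` for `hf`) in the final proofs of the sequels.
`noncomputable section`, `open scoped Classical`.
-/

noncomputable section

open scoped Classical NNReal NumberField AddSubgroup
open NumberField IsDedekindDomain Polynomial

namespace Literature.NumberTheory.EllipticCurves

open _root_.WeierstrassCurve Literature.NumberTheory.GaloisRepresentations Field
  IsDedekindDomain.HeightOneSpectrum

/-! ## The pinned local setup and the pinned reduction map -/

section Pinned

variable {K : Type} [Field K] [NumberField K] (W : WeierstrassCurve K) (v : HeightOneSpectrum (𝓞 K))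

/-- **The pinned local setup exists**: for `E/K` with good reduction at `v`, with `w = |·|_v`
the CHOSEN spectral valuation (`v.spectralValuation`), the structure map
`φ : 𝓞_v → 𝒪_w` makes `MO = M.map φ` (the local minimal model over the valuation ring of `K̄_v`)
a curve with unit discriminant and `M_{K̄_v} = MO_{K̄_v}` (Steps 0–1 of Part II of
`OrdinaryReductionTateModuleProofs`, pinned; Silverman VII.2.1, VII.5.1(a)).
[cite: SilvermanAEC2009, Prop. VII.2.1 and Prop. VII.5.1(a)] -/
theorem exists_pinnedSetup (hgood : W.HasGoodReductionAt v) :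
    ∃ φ : v.adicCompletionIntegers K →+* (v.spectralValuation).valuationSubring,
      (∀ c, ((φ c : (v.spectralValuation).valuationSubring) : AlgebraicClosure (v.adicCompletion K)) =
        algebraMap (v.adicCompletion K) (AlgebraicClosure (v.adicCompletion K)) c) ∧
      IsUnit ((W.localMinimalIntegralModel v).map φ).Δ ∧
      ((W.localMinimalIntegralModel v).map
          (algebraMap (v.adicCompletionIntegers K) (v.adicCompletion K))).baseChange
            (AlgebraicClosure (v.adicCompletion K)) =
        ((W.localMinimalIntegralModel v).map φ).baseChange (AlgebraicClosure (v.adicCompletion K)) := by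
  have hw := coe_spectralValuation v
  let φ : v.adicCompletionIntegers K →+* (v.spectralValuation).valuationSubring :=
    ((algebraMap (v.adicCompletion K) (AlgebraicClosure (v.adicCompletion K))).comp
      (algebraMap (v.adicCompletionIntegers K) (v.adicCompletion K))).codRestrict _ fun a ↦
      (Valuation.mem_valuationSubring_iff _ _).mpr
        ((spectralValuation_algebraMap_le_one_iff hw _).mpr a.2)
  refine ⟨φ, fun _ ↦ rfl, ?_, ?_⟩
  · rw [map_Δ]
    exact (isUnit_Δ_localMinimalIntegralModel hgood).map φ
  · rw [baseChange, baseChange, WeierstrassCurve.map_map, WeierstrassCurve.map_map]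
    rfl

end Pinned

section Setup

variable {K : Type} [Field K] [NumberField K] (W : WeierstrassCurve K) [W.IsElliptic]
  (p : ℕ) [hp : Fact p.Prime] (v : HeightOneSpectrum (𝓞 K))
  {φ : v.adicCompletionIntegers K →+* (v.spectralValuation).valuationSubring}
  (hΔO : IsUnit ((W.localMinimalIntegralModel v).map φ).Δ)
  (hX : ((W.localMinimalIntegralModel v).map
      (algebraMap (v.adicCompletionIntegers K) (v.adicCompletion K))).baseChange
        (AlgebraicClosure (v.adicCompletion K)) =
      ((W.localMinimalIntegralModel v).map φ).baseChange (AlgebraicClosure (v.adicCompletion K)))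
  (f : geomPoints W →+
    (((W.localMinimalIntegralModel v).map φ).map
      (IsLocalRing.residue (v.spectralValuation).valuationSubring)).toAffine.Point)
  (hf : ∀ a, f a = goodReductionHom ((W.localMinimalIntegralModel v).map φ)
    (Valuation.valuationSubring.integers v.spectralValuation) hΔO
    (Affine.Point.congrEquiv hX (W.localPointsEquivModel v (pointsMap W (v.adicCompletion K) a))))

include hf

omit [W.IsElliptic] in
/-- **The kernel of the pinned reduction map is `ι⁻¹ E₁(K̄_v)`**: `f a = 0` iff the image of
`a ∈ E(K̄)` under the chosen embedding `E(K̄) → E(K̄_v)` lies in the kernel of reduction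
`W.localKernelOfReduction v` (both say: the point of the minimal model has non-integral `x`;
`goodReductionHom_eq_zero_iff`, `mem_localKernelOfReduction_iff_of_eq_some`).  Greenberg's
"`C_v = 𝓕(m̄)[p^∞]`", LNM 1716 §2 pp. 70–71. [cite: GreenbergLNM1716, §2 pp. 70–71 (held copy p0073)] -/
theorem reductionMap_eq_zero_iff_mem_localKernelOfReduction (a : geomPoints W) :
    f a = 0 ↔ pointsMapOfEmb W (closureEmb (v.adicCompletion K)) a ∈ W.localKernelOfReduction v := by
  have hvO : (v.spectralValuation).Integers (v.spectralValuation).valuationSubring :=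
    Valuation.valuationSubring.integers _
  rw [hf, goodReductionHom_eq_zero_iff]
  change _ ↔ pointsMap W (v.adicCompletion K) a ∈ W.localKernelOfReduction v
  rcases hQ : W.localPointsEquivModel v (pointsMap W (v.adicCompletion K) a) with _ | ⟨x, y, h⟩
  · rw [← Affine.Point.zero_def, Affine.Point.congrEquiv_zero]
    exact iff_of_true reducesToZero_zero (W.mem_localKernelOfReduction_of_eq_zero v hQ)
  · rw [Affine.Point.congrEquiv_some, reducesToZero_some_iff, not_mem_range_iff hvO,
      W.mem_localKernelOfReduction_iff_of_eq_some v hQ]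

variable {W p v} in
include hp in
/-- **The pinned reduction map at a good ORDINARY `v ∣ p`: stability, inertia invariance and
the counts.**  `ker f` is `Γ_{K_v}`-stable and `f` is invariant under the inertia group
(`goodReduction_reduction_line` at `Φ₀ = W.localPointsEquivModel v`); `#E(K̄)[pⁿ] = p²ⁿ`
(Silverman III.6.4), `#MO~(k_w)[pⁿ] = pⁿ` and `f` maps `E(K̄)[pⁿ]` ONTO `MO~(k_w)[pⁿ]` (Steps 2–3
and 6 of Part II of `OrdinaryReductionTateModuleProofs`: Greenberg LNM 1716 p. 62 /
Silverman V.3.1 via `natCard_torsionBy_ker_goodReductionHom_eq`, all torsion of `E(K̄_v)` being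
algebraic).  Greenberg 1991 §2 ("surjective … ranks `2, 1, 1`").
[cite: Greenberg1991, §2 (p. 214)] [cite: GreenbergLNM1716, §2 p. 62 and pp. 70–71]
[cite: SilvermanAEC2009, Cor. III.6.4, Thm. V.3.1, Prop. VII.2.1] -/
theorem reductionMap_stable_invariant_counts (hpv : (p : 𝓞 K) ∈ v.asIdeal)
    (hgood : W.HasGoodReductionAt v) (hord : ¬ ((p : ℤ) ∣ W.frobeniusTraceAt v)) :
    (∀ (σ : absoluteGaloisGroup (v.adicCompletion K)) (a : geomPoints W),
        f a = 0 → f (absGaloisRestrict K (v.adicCompletion K) σ • a) = 0) ∧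
      (∀ σ ∈ absInertia (v.adicCompletion K), ∀ a : geomPoints W,
        f (absGaloisRestrict K (v.adicCompletion K) σ • a) = f a) ∧
      (∀ n, Nat.card ((geomPoints W)[(p ^ n : ℕ)]) = p ^ (2 * n)) ∧
      (∀ n, Nat.card ((((W.localMinimalIntegralModel v).map φ).map
        (IsLocalRing.residue (v.spectralValuation).valuationSubring)).toAffine.Point[(p ^ n : ℕ)]) =
          p ^ (1 * n)) ∧
      (∀ n, ∀ y ∈ (((W.localMinimalIntegralModel v).map φ).map
        (IsLocalRing.residue (v.spectralValuation).valuationSubring)).toAffine.Point[(p ^ n : ℕ)],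
          ∃ x ∈ (geomPoints W)[(p ^ n : ℕ)], f x = y) := by
  haveI : CharZero (v.adicCompletion K) :=
    charZero_of_injective_algebraMap (algebraMap K (v.adicCompletion K)).injective
  haveI : CharZero (AlgebraicClosure (v.adicCompletion K)) :=
    charZero_of_injective_algebraMap
      (algebraMap (v.adicCompletion K) (AlgebraicClosure (v.adicCompletion K))).injective
  have hw := coe_spectralValuation v
  have hvO : (v.spectralValuation).Integers (v.spectralValuation).valuationSubring :=
    Valuation.valuationSubring.integers _
  obtain ⟨hstab, hinv, -⟩ := goodReduction_reduction_line W p v hpv hgood hord hw hΔO hX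
    (W.localPointsEquivModel v) (W.localPointsEquivModel_smul v) f hf
  refine ⟨hstab, hinv, ?_⟩
  haveI hMOell : ((W.localMinimalIntegralModel v).map φ).IsElliptic := ⟨hΔO⟩
  -- residue characteristic `p` on both sides
  have hpO : v.spectralValuation ((p : ℕ) : AlgebraicClosure (v.adicCompletion K)) < 1 := by
    have h := spectralValuation_algebraMap_ringOfIntegers_lt_one (v := v) hw hpv
    rwa [map_natCast] at h
  haveI hchar : CharP (IsLocalRing.ResidueField (v.spectralValuation).valuationSubring) p := by
    refine (CharP.charP_iff_prime_eq_zero hp.out).mpr ?_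
    rw [← map_natCast (IsLocalRing.residue _), IsLocalRing.residue_eq_zero_iff,
      IsLocalRing.mem_maximalIdeal, mem_nonunits_iff, hvO.isUnit_iff_valuation_eq_one]
    exact fun h ↦ absurd h (ne_of_lt (by simpa using hpO))
  haveI hcharv : CharP (IsLocalRing.ResidueField (v.adicCompletionIntegers K)) p := by
    refine (CharP.charP_iff_prime_eq_zero hp.out).mpr ?_
    have h := (residue_algebraMap_eq_zero_iff K v (p : 𝓞 K)).mpr hpv
    rwa [map_natCast, map_natCast] at h
  -- Step 2 ("good, ordinary"): some `p`-torsion point of `MO(K̄_v)` has non-zero reduction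
  haveI := isElliptic_reductionAt hgood
  have hEv : W.reductionAt v = (W.localMinimalIntegralModel v).map
      (IsLocalRing.residue (v.adicCompletionIntegers K)) := rfl
  have hdegE : ((W.reductionAt v).ΨSq p).natDegree ≠ 0 :=
    natDegree_ΨSq_ne_zero_of_not_dvd_trace (W.reductionAt v) p
      (by rwa [frobeniusTraceAt_def] at hord)
  have hdegMO : ((((W.localMinimalIntegralModel v).map φ).ΨSq p).map
      (IsLocalRing.residue (v.spectralValuation).valuationSubring)).natDegree ≠ 0 := by
    rw [WeierstrassCurve.map_ΨSq]
    refine natDegree_map_map_residue_ne_zero φ _ ?_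
    rwa [hEv, WeierstrassCurve.map_ΨSq] at hdegE
  have hordMO := exists_zsmul_eq_zero_goodReductionHom_ne_zero
    (v.spectralValuation).valuationSubring hvO hΔO p hdegMO
  -- Step 3 ("surjective … ranks 2, 1, 1")
  have h5 := fun r ↦ natCard_torsionBy_ker_goodReductionHom_eq
    (v.spectralValuation).valuationSubring hvO hΔO hordMO r
  set red := goodReductionHom ((W.localMinimalIntegralModel v).map φ) hvO hΔO with hreddef
  -- Step 6: counting
  have hp0 : ∀ n : ℕ, p ^ n ≠ 0 := fun n ↦ pow_ne_zero n hp.out.ne_zero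
  have hA : ∀ n, Nat.card ((geomPoints W)[(p ^ n : ℕ)]) = p ^ (2 * n) := by
    intro n
    have h := card_torsionBy_eq_sq (E := W.baseChange (AlgebraicClosure K)) (n := p ^ n)
      (by exact_mod_cast hp0 n)
    rw [← pow_mul, mul_comm] at h
    exact h
  have hcardL : ∀ n,
      Nat.card ((localPoints W (v.adicCompletion K))[(p ^ n : ℕ)]) = p ^ (2 * n) := by
    intro n
    have h := card_torsionBy_eq_sq (E := W.baseChange (AlgebraicClosure (v.adicCompletion K)))
      (n := p ^ n) (by exact_mod_cast hp0 n)
    rw [← pow_mul, mul_comm] at h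
    exact h
  have hcardMO : ∀ n, Nat.card
      (((((W.localMinimalIntegralModel v).map φ).baseChange
        (AlgebraicClosure (v.adicCompletion K))).toAffine.Point)[(p ^ n : ℕ)]) = p ^ n * p ^ n := by
    intro n
    have h := card_torsionBy_eq_sq
      (E := ((W.localMinimalIntegralModel v).map φ).baseChange (AlgebraicClosure (v.adicCompletion K)))
      (n := p ^ n) (by exact_mod_cast hp0 n)
    rw [sq] at h
    exact h
  have hsurjred : ∀ n, ∀ y ∈ ((((W.localMinimalIntegralModel v).map φ).map
      (IsLocalRing.residue (v.spectralValuation).valuationSubring)).toAffine.Point)[(p ^ n : ℕ)],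
      ∃ P ∈ ((((W.localMinimalIntegralModel v).map φ).baseChange
        (AlgebraicClosure (v.adicCompletion K))).toAffine.Point)[(p ^ n : ℕ)], red P = y := by
    intro n y hy
    obtain ⟨P, hP, hPy⟩ := (h5 n).2 y (mem_torsionBy_iff.mp hy)
    exact ⟨P, mem_torsionBy_iff.mpr hP, hPy⟩
  have hB : ∀ n, Nat.card (((((W.localMinimalIntegralModel v).map φ).map
      (IsLocalRing.residue (v.spectralValuation).valuationSubring)).toAffine.Point)[(p ^ n : ℕ)]) =
      p ^ (1 * n) := by
    intro n
    have hmul := TateModule.card_ker_torsionBy_mul_card red (p ^ n) (hsurjred n)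
    have hker : Nat.card ((red.ker)[(p ^ n : ℕ)]) = p ^ n := by
      have h := (h5 n).1
      rwa [← Nat.cast_pow] at h
    rw [hker, hcardMO n] at hmul
    rw [one_mul]
    exact Nat.eq_of_mul_eq_mul_left (Nat.pos_of_ne_zero (hp0 n)) hmul
  have hsurj : ∀ n, ∀ y ∈ ((((W.localMinimalIntegralModel v).map φ).map
      (IsLocalRing.residue (v.spectralValuation).valuationSubring)).toAffine.Point)[(p ^ n : ℕ)],
      ∃ x ∈ (geomPoints W)[(p ^ n : ℕ)], f x = y := by
    intro n y hy
    obtain ⟨P, hP, hPy⟩ := hsurjred n y hy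
    set Q : localPoints W (v.adicCompletion K) :=
      (W.localPointsEquivModel v).symm ((Affine.Point.congrEquiv hX).symm P) with hQdef
    have hQ : Q ∈ (localPoints W (v.adicCompletion K))[(p ^ n : ℕ)] := by
      rw [mem_torsionBy_iff, hQdef, ← map_zsmul, ← map_zsmul, mem_torsionBy_iff.mp hP, map_zero,
        map_zero]
    haveI : Finite ((localPoints W (v.adicCompletion K))[(p ^ n : ℕ)]) :=
      Nat.finite_of_card_ne_zero (by rw [hcardL]; exact hp0 _)
    obtain ⟨x, hx, hxQ⟩ := exists_mem_torsionBy_eq_of_injective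
      (pointsMap W (v.adicCompletion K))
      (pointsMapOfEmb_injective W (closureEmb (K := K) (v.adicCompletion K))) (p ^ n)
      (le_of_eq (by rw [hcardL, hA])) Q hQ
    refine ⟨x, hx, ?_⟩
    rw [hf, hxQ, hQdef, AddEquiv.apply_symm_apply, AddEquiv.apply_symm_apply, hPy]
  exact ⟨hA, hB, hsurj⟩

end Setup

end Literature.NumberTheory.EllipticCurves

end
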